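import Summits.RiemannHypothesis.RiemannHypothesis.Theorems.IntegerScrewCensusFastCheckB

/-!
# Route `IntegerScrew` — fast kernel arithmetic for manifest-certificate checks (6): semantics of the packed nodes

The INTEGER layer of the soundness of `fastCheckB` (`IntegerScrewCensusFastCheck`/`…CheckB`): the digits `digW`/`digP` as
integers (no truncation under `Ω < 2^60`, `|x| ≤ 2^53`), the packing passes `packW`/`packPB` ARE the tree's Kronecker
packings `packN`/`packRevN` with digit sums `sumN` (`Literature…KroneckerDot`), the shift-and-mask dot product `kdotS` is
`kdotN` and hence the exact dot product of the digit vectors (`kdotN_packN_packRevN`), the column sums `colSums`, and the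
list bookkeeping of `lowRow`/`lowTri`/`packAllB`/`rowsOK` (`getD` characterisations).  Pure arithmetic; RH-free and ζ-free;
nothing here bears on the truth of RH.  Sequel: `IntegerScrewCensusFastSound` (the real-number layer and `ManifestCert`).
-/

set_option linter.dupNamespace false
set_option autoImplicit false

namespace Summit.RiemannHypothesis.RiemannHypothesis.Theorems.IntegerScrew.Manifest.Fast

open Finset
open Literature.Analysis.ValidatedNumerics Literature.Analysis.ValidatedNumerics.Numerics
open Literature.Analysis.ValidatedNumerics.KroneckerDot

/-! ### Digits -/

/-- `D0 = 2^113` in `ℤ`. -/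
theorem D0_val : (D0 : ℤ) = 2 ^ 113 := by norm_num [D0]
/-- `D1 = 2^53` in `ℤ`. -/
theorem D1_val : (D1 : ℤ) = 2 ^ 53 := by norm_num [D1]

/-- **The weighted digit as an integer**: `digW Ω X = Ω·x + D0` (`x = oval X`), no truncation. -/
theorem digW_eq {o X : ℕ} (ho : o < 2 ^ 60) (hx : |oval X| ≤ 2 ^ 53) : (digW o X : ℤ) = o * oval X + D0 := by
  unfold digW
  have e : (X : ℤ) = oval X + OFF := cast_eq_oval X
  obtain ⟨h1, h2⟩ := abs_le.1 hx
  have ho' : (o : ℤ) < 2 ^ 60 := by exact_mod_cast ho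
  have hle : o * OFF ≤ o * X + D0 := by
    have : (o : ℤ) * OFF ≤ o * X + D0 := by
      rw [e, D0_val]; nlinarith [OFF_val]
    exact_mod_cast this
  simp only [Nat.add_eq, Nat.mul_eq, Nat.sub_eq]
  push_cast [Nat.cast_sub hle]
  rw [e]; ring

/-- The weighted digit is `< 2^114`. -/
theorem digW_lt {o X : ℕ} (ho : o < 2 ^ 60) (hx : |oval X| ≤ 2 ^ 53) : digW o X < 2 ^ 114 := by
  have h := digW_eq ho hx
  obtain ⟨h1, h2⟩ := abs_le.1 hx
  have ho' : (o : ℤ) < 2 ^ 60 := by exact_mod_cast ho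
  have : (digW o X : ℤ) < 2 ^ 114 := by
    rw [h, D0_val]; nlinarith
  exact_mod_cast this

/-- **The plain digit as an integer**: `digP X = x + D1`, no truncation. -/
theorem digP_eq {X : ℕ} (hx : |oval X| ≤ 2 ^ 53) : (digP X : ℤ) = oval X + D1 := by
  unfold digP
  have e : (X : ℤ) = oval X + OFF := cast_eq_oval X
  obtain ⟨h1, h2⟩ := abs_le.1 hx
  have hle : OFF ≤ X + D1 := by
    have : (OFF : ℤ) ≤ X + D1 := by rw [e, D1_val]; nlinarith
    exact_mod_cast this
  simp only [Nat.add_eq, Nat.sub_eq]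
  push_cast [Nat.cast_sub hle]
  rw [e]; ring

/-- The plain digit is `≤ 2^54`. -/
theorem digP_le {X : ℕ} (hx : |oval X| ≤ 2 ^ 53) : digP X ≤ 2 ^ 54 := by
  have h := digP_eq hx
  obtain ⟨h1, h2⟩ := abs_le.1 hx
  have : (digP X : ℤ) ≤ 2 ^ 54 := by rw [h, D1_val]; nlinarith
  exact_mod_cast this

/-! ### The packing passes are Kronecker packings -/

/-- Weighted cos digits of a row. -/
def dWc (oms : List ℕ) (row : List (ℕ × ℕ)) : List ℕ := List.zipWith (fun o p => digW o p.1) oms row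
/-- Weighted sin digits of a row. -/
def dWs (oms : List ℕ) (row : List (ℕ × ℕ)) : List ℕ := List.zipWith (fun o p => digW o p.2) oms row
/-- Plain cos digits of a row. -/
def dPc (row : List (ℕ × ℕ)) : List ℕ := row.map fun p => digP p.1
/-- Plain sin digits of a row. -/
def dPs (row : List (ℕ × ℕ)) : List ℕ := row.map fun p => digP p.2

/-- **`packW` = (`packN` of the weighted cos digits, of the sin digits, their sums).** -/
theorem packW_eq : ∀ (oms : List ℕ) (row : List (ℕ × ℕ)),
    packW oms row = (packN WS (dWc oms row), packN WS (dWs oms row), sumN (dWc oms row), sumN (dWs oms row))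
  | [], row => by rw [packW_nil]; cases row <;> rfl
  | o :: os, [] => by rw [packW_cons_nil]; rfl
  | o :: os, p :: ps => by rw [packW_cons, packW_eq os ps]; rfl

/-- **`packPB` = (`packRevN` of the plain cos digits, of the sin digits, their sums, the power `W^L`).** -/
theorem packPB_eq : ∀ (row : List (ℕ × ℕ)),
    packPB row = (packRevN WS row.length (dPc row), packRevN WS row.length (dPs row), sumN (dPc row), sumN (dPs row),
      WS ^ row.length)
  | [] => by rw [packPB_nil]; rfl
  | p :: ps => by
    rw [packPB_cons, packPB_eq ps]
    simp only [dPc, dPs, List.map_cons, List.length_cons, packRevN, Nat.add_sub_cancel, sumN, pow_succ]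
    refine Prod.ext rfl (Prod.ext rfl (Prod.ext rfl (Prod.ext rfl ?_)))
    simp only
    ring

/-! ### Digit lists: lengths and bounds -/

/-- A row is IN RANGE: every stored component has `|x| ≤ 2^53`. -/
def RowSmall (row : List (ℕ × ℕ)) : Prop := ∀ p ∈ row, |oval p.1| ≤ 2 ^ 53 ∧ |oval p.2| ≤ 2 ^ 53

/-- All weights `< 2^60`. -/
def OmSmall (oms : List ℕ) : Prop := ∀ o ∈ oms, o < 2 ^ 60

/-- Length of the weighted cos digits. -/
theorem length_dWc (oms : List ℕ) (row : List (ℕ × ℕ)) : (dWc oms row).length = min oms.length row.length := by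
  simp [dWc]
/-- Length of the weighted sin digits. -/
theorem length_dWs (oms : List ℕ) (row : List (ℕ × ℕ)) : (dWs oms row).length = min oms.length row.length := by
  simp [dWs]
/-- Length of the plain cos digits. -/
theorem length_dPc (row : List (ℕ × ℕ)) : (dPc row).length = row.length := by simp [dPc]
/-- Length of the plain sin digits. -/
theorem length_dPs (row : List (ℕ × ℕ)) : (dPs row).length = row.length := by simp [dPs]

/-- Bound of the weighted cos digits. -/
theorem dWc_bound {oms : List ℕ} {row : List (ℕ × ℕ)} (ho : OmSmall oms) (hr : RowSmall row) :
    ∀ x ∈ dWc oms row, x ≤ 2 ^ 114 := by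
  intro x hx
  unfold dWc at hx
  rw [List.mem_iff_getElem] at hx
  obtain ⟨i, hi, rfl⟩ := hx
  rw [List.length_zipWith] at hi
  rw [List.getElem_zipWith]
  exact (digW_lt (ho _ (List.getElem_mem _)) (hr _ (List.getElem_mem _)).1).le

/-- Bound of the weighted sin digits. -/
theorem dWs_bound {oms : List ℕ} {row : List (ℕ × ℕ)} (ho : OmSmall oms) (hr : RowSmall row) :
    ∀ x ∈ dWs oms row, x ≤ 2 ^ 114 := by
  intro x hx
  unfold dWs at hx
  rw [List.mem_iff_getElem] at hx
  obtain ⟨i, hi, rfl⟩ := hx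
  rw [List.length_zipWith] at hi
  rw [List.getElem_zipWith]
  exact (digW_lt (ho _ (List.getElem_mem _)) (hr _ (List.getElem_mem _)).2).le

/-- Bound of the plain cos digits. -/
theorem dPc_bound {row : List (ℕ × ℕ)} (hr : RowSmall row) : ∀ x ∈ dPc row, x ≤ 2 ^ 54 := by
  intro x hx
  unfold dPc at hx
  rw [List.mem_map] at hx
  obtain ⟨p, hp, rfl⟩ := hx
  exact digP_le (hr p hp).1

/-- Bound of the plain sin digits. -/
theorem dPs_bound {row : List (ℕ × ℕ)} (hr : RowSmall row) : ∀ x ∈ dPs row, x ≤ 2 ^ 54 := by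
  intro x hx
  unfold dPs at hx
  rw [List.mem_map] at hx
  obtain ⟨p, hp, rfl⟩ := hx
  exact digP_le (hr p hp).2

/-- Values of the weighted cos digits. -/
theorem getD_dWc {oms : List ℕ} {row : List (ℕ × ℕ)} {k : ℕ} (hk : k < oms.length) (hk' : k < row.length) :
    (dWc oms row).getD k 0 = digW (oms.getD k 0) (row.getD k (0, 0)).1 := by
  unfold dWc
  rw [List.getD_eq_getElem _ _ (by rw [List.length_zipWith]; omega), List.getElem_zipWith,
    List.getD_eq_getElem _ _ hk, List.getD_eq_getElem _ _ hk']

/-- Values of the weighted sin digits. -/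
theorem getD_dWs {oms : List ℕ} {row : List (ℕ × ℕ)} {k : ℕ} (hk : k < oms.length) (hk' : k < row.length) :
    (dWs oms row).getD k 0 = digW (oms.getD k 0) (row.getD k (0, 0)).2 := by
  unfold dWs
  rw [List.getD_eq_getElem _ _ (by rw [List.length_zipWith]; omega), List.getElem_zipWith,
    List.getD_eq_getElem _ _ hk, List.getD_eq_getElem _ _ hk']

/-- Values of the plain cos digits. -/
theorem getD_dPc {row : List (ℕ × ℕ)} {k : ℕ} (hk : k < row.length) :
    (dPc row).getD k 0 = digP (row.getD k (0, 0)).1 := by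
  unfold dPc
  rw [List.getD_eq_getElem _ _ (by rw [List.length_map]; omega), List.getElem_map, List.getD_eq_getElem _ _ hk]

/-- Values of the plain sin digits. -/
theorem getD_dPs {row : List (ℕ × ℕ)} {k : ℕ} (hk : k < row.length) :
    (dPs row).getD k 0 = digP (row.getD k (0, 0)).2 := by
  unfold dPs
  rw [List.getD_eq_getElem _ _ (by rw [List.length_map]; omega), List.getElem_map, List.getD_eq_getElem _ _ hk]

/-! ### The shift-and-mask dot product -/

/-- `kdotS (180(K−1)) A B = kdotN 2^180 K A B`. -/
theorem kdotS_eq_kdotN (K A B : ℕ) : kdotS (WB * (K - 1)) A B = kdotN WS K A B := by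
  show (A * B) >>> (WB * (K - 1)) &&& (2 ^ 180 - 1) = A * B / WS ^ (K - 1) % WS
  rw [Nat.shiftRight_eq_div_pow, Nat.and_two_pow_sub_one_eq_mod, WS, WB, ← pow_mul]

/-- **The Kronecker dot products of a pair are the exact digit dot products** (`K ≤ 512` atoms). -/
theorem kdotS_pack {K : ℕ} (hK : 1 ≤ K) (hK' : K ≤ 512) {a b : List ℕ} (ha : a.length ≤ K) (hb : b.length ≤ K)
    (hMa : ∀ x ∈ a, x ≤ 2 ^ 114) (hMb : ∀ x ∈ b, x ≤ 2 ^ 54) :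
    kdotS (WB * (K - 1)) (packN WS a) (packRevN WS K b) = ∑ i ∈ range K, a.getD i 0 * b.getD i 0 := by
  rw [kdotS_eq_kdotN]
  refine kdotN_packN_packRevN hK ha hb hMa hMb ?_
  calc K * 2 ^ 114 * 2 ^ 54 ≤ 512 * 2 ^ 114 * 2 ^ 54 := by gcongr
    _ < WS := by norm_num [WS]

/-! ### Column sums and the list bookkeeping -/

/-- `addPrefix` adds entrywise (missing entries count `0`). -/
theorem getD_addPrefix : ∀ (xs ys : List ℕ) (i : ℕ), (addPrefix xs ys).getD i 0 = xs.getD i 0 + ys.getD i 0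
  | [], ys, i => by simp [addPrefix]
  | x :: xs, [], i => by cases i <;> simp [addPrefix]
  | x :: xs, y :: ys, 0 => by simp [addPrefix]
  | x :: xs, y :: ys, i + 1 => by
    simp only [addPrefix, List.getD_cons_succ]
    exact getD_addPrefix xs ys i

/-- **Column sums**: entry `i` of `colSums rows` is `Σ_r rows[r][i]` (missing entries `0`). -/
theorem getD_colSums : ∀ (rows : List (List ℕ)) (i : ℕ),
    (colSums rows).getD i 0 = ∑ r ∈ range rows.length, (rows.getD r []).getD i 0
  | [], i => by simp [colSums]
  | r :: rs, i => by
    rw [colSums, getD_addPrefix, getD_colSums rs i, List.length_cons, Finset.sum_range_succ', add_comm]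
    simp

/-- `lowRow`: length (the digit list is the shorter one). -/
theorem lowRow_length (sh gx gy : ℕ) (Pa : NodeP) :
    ∀ (Ps : List NodeP) (us : List (ℕ × ℕ)), us.length ≤ Ps.length → (lowRow sh gx gy Pa Ps us).length = us.length
  | [], [], _ => rfl
  | [], _ :: _, h => by simp at h
  | P :: Ps, [], _ => rfl
  | P :: Ps, u :: us, h => by
    rw [lowRow_cons, List.length_cons, List.length_cons, lowRow_length sh gx gy Pa Ps us (by simpa using h)]

/-- `lowRow`: entries. -/
theorem lowRow_getD (sh gx gy : ℕ) (Pa dP : NodeP) :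
    ∀ (Ps : List NodeP) (us : List (ℕ × ℕ)) (j : ℕ), j < us.length → us.length ≤ Ps.length →
      (lowRow sh gx gy Pa Ps us).getD j 0 = pairAbs sh gx gy Pa (Ps.getD j dP) (us.getD j (0, 0))
  | [], us, j, hj, h => by simp at h; subst h; simp at hj
  | P :: Ps, [], j, hj, _ => by simp at hj
  | P :: Ps, u :: us, 0, _, _ => by rw [lowRow_cons]; simp
  | P :: Ps, u :: us, j + 1, hj, h => by
    rw [lowRow_cons, List.getD_cons_succ, List.getD_cons_succ, List.getD_cons_succ]
    exact lowRow_getD sh gx gy Pa dP Ps us j (by simpa using hj) (by simpa using h)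

/-- `lowTri`: length. -/
theorem lowTri_length (sh G1 G2 : ℕ) (Ps : List NodeP) :
    ∀ (rest : List NodeP) (urows : List (List (ℕ × ℕ))), rest.length = urows.length →
      (lowTri sh G1 G2 Ps rest urows).length = rest.length
  | [], [], _ => rfl
  | [], _ :: _, h => by simp at h
  | _ :: _, [], h => by simp at h
  | P :: rest, urow :: urows, h => by
    rw [lowTri_cons, List.length_cons, List.length_cons, lowTri_length sh G1 G2 Ps rest urows (by simpa using h)]

/-- `lowTri`: rows. -/
theorem lowTri_getD (sh G1 G2 : ℕ) (Ps : List NodeP) (dP : NodeP) :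
    ∀ (rest : List NodeP) (urows : List (List (ℕ × ℕ))) (i : ℕ), i < rest.length → rest.length = urows.length →
      (lowTri sh G1 G2 Ps rest urows).getD i [] =
        lowRow sh (G1 + (rest.getD i dP).xa) (G2 + (rest.getD i dP).ya) (rest.getD i dP) Ps ((urows.getD i []).drop 2)
  | [], urows, i, hi, _ => by simp at hi
  | _ :: _, [], i, _, h => by simp at h
  | P :: rest, urow :: urows, 0, _, _ => by rw [lowTri_cons]; simp
  | P :: rest, urow :: urows, i + 1, hi, h => by
    rw [lowTri_cons, List.getD_cons_succ, List.getD_cons_succ, List.getD_cons_succ]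
    exact lowTri_getD sh G1 G2 Ps dP rest urows i (by simpa using hi) (by simpa using h)

/-- `packAllB`: length. -/
theorem packAllB_length (E1 : ℕ) (oms : List ℕ) :
    ∀ (drs : List (ℕ × List (ℕ × ℕ))) (urows : List (List (ℕ × ℕ))), drs.length = urows.length →
      (packAllB E1 oms drs urows).length = drs.length
  | [], [], _ => rfl
  | [], _ :: _, h => by simp at h
  | _ :: _, [], h => by simp at h
  | dr :: drs, urow :: urows, h => by
    rw [packAllB_cons, List.length_cons, List.length_cons, packAllB_length E1 oms drs urows (by simpa using h)]

/-- `packAllB`: entries. -/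
theorem packAllB_getD (E1 : ℕ) (oms : List ℕ) (dP : NodeP) :
    ∀ (drs : List (ℕ × List (ℕ × ℕ))) (urows : List (List (ℕ × ℕ))) (i : ℕ), i < drs.length →
      drs.length = urows.length →
      (packAllB E1 oms drs urows).getD i dP = packNodeB E1 oms (drs.getD i (0, [])) ((urows.getD i []).getD 1 (0, 0))
  | [], urows, i, hi, _ => by simp at hi
  | _ :: _, [], i, _, h => by simp at h
  | dr :: drs, urow :: urows, 0, _, _ => by rw [packAllB_cons]; simp
  | dr :: drs, urow :: urows, i + 1, hi, h => by
    rw [packAllB_cons, List.getD_cons_succ, List.getD_cons_succ, List.getD_cons_succ]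
    exact packAllB_getD E1 oms dP drs urows i (by simpa using hi) (by simpa using h)

/-- **`rowsOK` unrolled**: every node passes its row test, reading its lower row and its column sum. -/
theorem rowsOK_spec (CL WJS2 E1 : ℕ) (dP : NodeP) : ∀ (Ps : List NodeP) (tri : List (List ℕ)) (cs : List ℕ),
    rowsOK CL WJS2 E1 Ps tri cs = true →
      ∀ i, i < Ps.length →
        sumN (tri.getD i []) + cs.getD i 0 + 2 * OZ + ZB < diagLoN CL WJS2 E1 (Ps.getD i dP)
  | [], _, cs, _, i, hi => by simp at hi
  | _ :: _, [], cs, h, i, hi => by cases cs <;> simp [rowsOK] at h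
  | P :: Ps, r :: rs, [], h, i, hi => by
    simp only [rowsOK, Bool.and_eq_true, Nat.blt_eq, Nat.add_eq, Nat.mul_eq] at h
    obtain ⟨h1, h2⟩ := h
    cases i with
    | zero => simpa using h1
    | succ i => simpa using rowsOK_spec CL WJS2 E1 dP Ps rs [] h2 i (by simpa using hi)
  | P :: Ps, r :: rs, c :: cs, h, i, hi => by
    simp only [rowsOK, Bool.and_eq_true, Nat.blt_eq, Nat.add_eq, Nat.mul_eq] at h
    obtain ⟨h1, h2⟩ := h
    cases i with
    | zero => simpa using h1
    | succ i => simpa using rowsOK_spec CL WJS2 E1 dP Ps rs cs h2 i (by simpa using hi)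

/-- `sumN` of a `zipWith` as a `Finset` sum (for the error unit). -/
theorem sumN_zipWith (f : ℕ → ℕ → ℕ) : ∀ (js oms : List ℕ), js.length = oms.length →
    sumN (List.zipWith f js oms) = ∑ k ∈ range js.length, f (js.getD k 0) (oms.getD k 0)
  | [], [], _ => by simp [sumN]
  | [], _ :: _, h => by simp at h
  | _ :: _, [], h => by simp at h
  | j :: js, o :: oms, h => by
    rw [List.zipWith_cons_cons, sumN, sumN_zipWith f js oms (by simpa using h), List.length_cons,
      Finset.sum_range_succ', add_comm]
    simp

end Summit.RiemannHypothesis.RiemannHypothesis.Theorems.IntegerScrew.Manifest.Fast
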